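/-
Copyright (c) 2026 the pub-hodgecm-mathlib formalisation cell (harness21).  Prover seat hodgecm-mathlib-K2E4-p11 (g10) on the S4 valve (dealer K2E2-plan (g8), S4-R69 (1),
[H-loc] MODEL, file (M-3a)): THE CHART DATA OF THE ε-TWISTED TUBE AT A BASE POINT, PACKAGED — one `∃` delivering every chart-side letter of the loss W-LOC socket
★ `R90S4TwistedTubeSocketLoss.twistedTubeJacobianLocal_of_chartData_loss'` at the one-place model `G ≃ GL_m(K)`, from ★ (M-2) `R90S4TwistedTubeModelChart`
(R90-C131-p04) and ★ (M-1) `R90S4TwistedLinearEquiv` (this seat).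
Crux H413 `stmt-HodgeConjecture-24833`, lane `--supports … --as helper` (count-neutral).  THEOREMS ONLY (no `def`, no `instance`, no notation, no named-fact hypothesis, no `sorry`).
-/
import Summits.HodgeConjecture.HodgeConjecture.Theorems.R90S4TwistedTubeModelChart   -- ★ (M-2) p864971 (C131-p04): `exists_glChart`, `chart_link_gl`, `exists_tauHom`, `valBound_tau`, `continuous_tau`, `rho_eps_chart_inv_eq_cayley_tau`
import Summits.HodgeConjecture.HodgeConjecture.Theorems.R90S4TwistedLinearEquiv     -- ★ (M-1) p864950 (this seat): `exists_twistedLinearEquiv`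
import HarnessLib

/-!
# R90-TF · S4 (Ch. 13.1–2) · road (J̃♭) «TWISTED TUBE JACOBIAN», [H-loc] MODEL file (M-3a): THE CHART DATA OF THE ε-TWISTED TUBE AT A BASE POINT `b₀`, AS ONE PACKAGE

Dealt by the S4 dealer K2E2-plan (g8) (S4-R69 (1), 2026-09-05T03:18:29Z); design authority K2E4-p11 (g10) (S4-R61).  Seat K2E4-p11 (g10).
THE POINT.  (M-3b) `R90S4TwistedTubeModel.twistedTubeJacobianLocal_model` (R90-C131-p05) re-runs ★ `F0P3cStCharTSJacCartanIntegralPoint`'s steps (0)–(10) for the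
ε-TWISTED tube at a NON-integral base point: it feeds ★ WL2′ `twistedTubeJacobianLocal_of_chartData_loss'` (C131-p04) with ~40 binders.  This file delivers, in ONE
existential **`exists_twistedTubeChartData`**, every CHART-SIDE binder among them — in WL2′'s order and spelling at `ι := AddMonoidHom.id`, `t₀ := b₀`, third slot
`E := τ` — plus the extras (M-3b) needs for ★ (TJ3) (the two laws `hLz hLm` of `L`, so `hDχ` is by name) and for ★ `exists_depth` (`K`-linearity of `pM pT`,
`K^σ`-linearity of `L`, `L⁻¹`, `c 0 = 1`, open∕compact levels):
* the `GLₘ` Cayley chart `(Λ, c, σV, κ)` with `hΛ hc hcc hK0 hσ hσc hκ0 hκt hchart` — ★ (M-2) `exists_glChart` (★ C4u at the trivial form `J := 0`);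
* the twisted Cartan data `(pM, pT, L)` at `N := ρ(b₀ · ε b₀)` (`= ↑(ρ b₀) · τ(↑(ρ b₀)⁻¹)`) with `hsum hidem hpMc hpTc hL hLz hLm …` — ★ (M-1) `exists_twistedLinearEquiv`;
* the chart link `hcT hTc` to the centraliser torus `T = {g | ρ g γ = γ ρ g}` of a regular `γ` commuting with `b₀` (`b₀, ε b₀ ∈ T`) — ★ (M-2) `chart_link_gl`;
* the slot `E = τ` (`hE hEc`, ★ `valBound_tau`, `continuous_tau`) and the twist in the chart `hε : ρ(ε(c X))⁻¹ = cayley (E X)` — ★ `rho_eps_chart_inv_eq_cayley_tau`;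
* the product and tube maps `Ξ, Θ` by their formulas (`ι = id`: definitional).
NOT here (group∕measure side, (M-3b)): `T` closed, `b₀ ∈ T` as the base-point binder, the loss datum `(γ, γ′, a)` (★ `R90S4TwistedTubeDatum.exists_lossData`), the depth
`k₀` (★ `exists_depth`) and `k = k₀ + 2a`, the sub-box `Λ′` (★ `exists_subBox`), continuity of `ε`, the family `Ψ` and the weight `D`.
[Rogawski1990 §12.5 p. 186 (twisted Weyl integration formula); HarishChandra1970 Lemma 22; PlatonovRapinchuk1994 §3.3.]

HONEST LABEL: HC_CM is proved only modulo the 7 printed citations (2 remaining named inputs: hLiu418 = `stmt-HodgeConjecture-24832`, h413 = `stmt-HodgeConjecture-24833`)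
until rung 0 closes; this file closes no organ ((J̃♭) stays OPEN: it is row [H-data] of the [H-loc] MODEL head); count-neutral helper.

## References
* [Rogawski1990] J. Rogawski, *Automorphic Representations of Unitary Groups in Three Variables*, Ann. of Math. Stud. 123 (1990), §12.5 p. 186; §3.10 p. 33.
* [HarishChandra1970] Harish-Chandra (notes by G. van Dijk), *Harmonic Analysis on Reductive p-adic Groups*, LNM 162 (1970), Lemma 22.
* [PlatonovRapinchuk1994] V. Platonov, A. Rapinchuk, *Algebraic Groups and Number Theory* (1994), §3.3.
* [Labesse1999] J.-P. Labesse, *Cohomologie, stabilisation et changement de base*, Astérisque 257 (1999), §III.1.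
-/

set_option autoImplicit false
set_option linter.dupNamespace false

open Set Filter MeasureTheory MeasureTheory.Measure TopologicalSpace Topology Matrix ValuativeRel
open Literature.NumberTheory.Automorphic Literature.NumberTheory.Weil1982.UnitaryFinTopForm
open Summit.HodgeConjecture.HodgeConjecture.Cruxes.H413.F0P3cStCharTSCayleyChartHaar
open scoped Pointwise Topology ENNReal NNReal MatrixGroups

namespace Summit.HodgeConjecture.HodgeConjecture.R90.S4

variable {K : Type*} [Field K] [ValuativeRel K] [TopologicalSpace K] [IsNonarchimedeanLocalField K] [CharZero K] [SecondCountableTopology K] [T2Space K]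
  {m : ℕ}
  {G : Type*} [Group G] [TopologicalSpace G] [IsTopologicalGroup G] [LocallyCompactSpace G] [SecondCountableTopology G] [T2Space G]
  [MeasurableSpace G] [BorelSpace G]
  [MeasurableSpace (Matrix (Fin m) (Fin m) K)] [BorelSpace (Matrix (Fin m) (Fin m) K)]

/-- **THE CHART DATA OF THE ε-TWISTED TUBE AT A BASE POINT `b₀`, PACKAGED.**  `G ≃ GL_m(K)` by `ρ` (inducing, injective, surjective); `σ` a continuous involution of the
local field `K` not increasing valuations, `J` hermitian invertible with `J`, `J⁻¹` integral (`τ X = J⁻¹ (X.map σ)ᵀ J`); `ε : G → G` the twist read by `ρ (ε g) = τ((ρ g)⁻¹)`;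
`T = {g | ρ g` commutes with `γ}` the centraliser torus of a regular `γ`; `b₀ ∈ T` a base point with `ε b₀ ∈ T`, `b₀ ε(b₀) = ε(b₀) b₀` and `N := ρ(b₀ ε b₀)` regular; radii
`0 ≠ α < 1`, `2 ≠ 0`; Haar data `μ` on `M_m(K)`, `ν` on `G`.  Then there are levels `Λ`, a chart `c`, a chart product `σV`, a constant `κ`, projections `pM pT`, the twisted linear
part `L`, the slot `E = τ`, and the maps `Ξ Θ`, satisfying EVERY chart-side binder of ★ `twistedTubeJacobianLocal_of_chartData_loss'` at `ι := AddMonoidHom.id`, `t₀ := b₀`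
(first block, in the socket's order), the two laws of ★ (TJ3) for `L` at `N` (second block), and the scaling letters of ★ `exists_depth` (third block).
[cite: Rogawski1990, §12.5 p. 186] [cite: HarishChandra1970, Lemma 22] [cite: PlatonovRapinchuk1994, §3.3] [cite: Labesse1999, §III.1] -/
theorem exists_twistedTubeChartData
    (ρ : G →* GL (Fin m) K) (hρ : IsInducing ρ) (hρinj : Function.Injective ρ) (hρsurj : Function.Surjective ρ)
    (σ : K →+* K) (hσc : Continuous σ) (hσ2 : ∀ a, σ (σ a) = a) (hσv : ∀ x, valuation K (σ x) ≤ valuation K x)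
    (J : Matrix (Fin m) (Fin m) K) (hJ : IsUnit J.det) (hJh : (J.map σ)ᵀ = J) (hJ1 : ValBound 1 J) (hJi1 : ValBound 1 J⁻¹)
    (ε : G → G) (hερ : ∀ g : G, ((ρ (ε g) : GL (Fin m) K) : Matrix (Fin m) (Fin m) K) = J⁻¹ * ((((ρ g)⁻¹ : GL (Fin m) K) : Matrix (Fin m) (Fin m) K).map σ)ᵀ * J)
    {γ : GL (Fin m) K} (hγsep : (γ : Matrix (Fin m) (Fin m) K).charpoly.Separable)
    {T : Subgroup G} (hT : ∀ g, g ∈ T ↔ ρ g * γ = γ * ρ g)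
    (b₀ : G) (hb₀ : b₀ ∈ T) (hεb₀ : ε b₀ ∈ T) (hcomm : b₀ * ε b₀ = ε b₀ * b₀)
    (hsep : ((ρ (b₀ * ε b₀) : GL (Fin m) K) : Matrix (Fin m) (Fin m) K).charpoly.Separable)
    {α : ValueGroupWithZero K} (hα : α ≠ 0) (hα1 : α < 1) (h2 : (2 : K) ≠ 0)
    (μ : Measure (Matrix (Fin m) (Fin m) K)) [μ.IsAddHaarMeasure] (ν : Measure G) [ν.IsHaarMeasure] :
    ∃ (Λ : ℕ → AddSubgroup (Matrix (Fin m) (Fin m) K)) (c : Matrix (Fin m) (Fin m) K → G)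
      (σV : Matrix (Fin m) (Fin m) K → Matrix (Fin m) (Fin m) K → Matrix (Fin m) (Fin m) K) (κ : ℝ≥0∞)
      (pM pT : Matrix (Fin m) (Fin m) K →+ Matrix (Fin m) (Fin m) K) (L : Matrix (Fin m) (Fin m) K ≃ₜ+ Matrix (Fin m) (Fin m) K)
      (E : Matrix (Fin m) (Fin m) K →+ Matrix (Fin m) (Fin m) K) (Ξ Θ : Matrix (Fin m) (Fin m) K → Matrix (Fin m) (Fin m) K),
      -- ── first block: the chart-side binders of ★ WL2′, in its order (`ι := AddMonoidHom.id`, `t₀ := b₀`)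
      (∀ j X, X ∈ Λ j ↔ ValBound (α ^ (j + 1)) X) ∧
      (∀ X ∈ Λ 0, ((ρ (c X) : GL (Fin m) K) : Matrix (Fin m) (Fin m) K) = cayley X) ∧
      ContinuousOn c (Λ 0 : Set (Matrix (Fin m) (Fin m) K)) ∧ IsOpen (c '' (Λ 0 : Set (Matrix (Fin m) (Fin m) K))) ∧
      (∀ W ∈ Λ 0, ∀ X ∈ Λ 0, σV W X = (1 - W)⁻¹ * (W + X) * (1 + W * X)⁻¹ * (1 - W)) ∧
      (∀ W ∈ Λ 0, ContinuousOn (σV W) (Λ 0 : Set (Matrix (Fin m) (Fin m) K))) ∧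
      (∀ Z, pM Z + pT Z = Z) ∧ (∀ Z, pM (pM Z) = pM Z) ∧ Continuous pM ∧ Continuous pT ∧
      (∀ Z, Ξ Z = (1 - pM Z)⁻¹ * (pM Z + pT Z) * (1 + pM Z * pT Z)⁻¹ * (1 - pM Z)) ∧
      (∀ Y ∈ Λ 0, pM Y = 0 → c Y ∈ T) ∧ (∀ W ∈ Λ 0, c W ∈ T → pM W = 0) ∧
      (∀ (δ : ValueGroupWithZero K) (W : Matrix (Fin m) (Fin m) K), ValBound δ W → ValBound δ (E W)) ∧ Continuous E ∧
      (∀ Z, L Z = (((ρ b₀)⁻¹ : GL (Fin m) K) : Matrix (Fin m) (Fin m) K) * pM Z * ((ρ b₀ : GL (Fin m) K) : Matrix (Fin m) (Fin m) K) + E (pM Z) + pT Z) ∧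
      (∀ X ∈ Λ 0, (((ρ (ε (c X)))⁻¹ : GL (Fin m) K) : Matrix (Fin m) (Fin m) K) = cayley (E X)) ∧
      (∀ Z, Θ Z =
        (fun W X : Matrix (Fin m) (Fin m) K => (1 - W)⁻¹ * (W + X) * (1 + W * X)⁻¹ * (1 - W))
          ((((ρ b₀)⁻¹ : GL (Fin m) K) : Matrix (Fin m) (Fin m) K) * pM Z * ((ρ b₀ : GL (Fin m) K) : Matrix (Fin m) (Fin m) K))
          ((fun W X : Matrix (Fin m) (Fin m) K => (1 - W)⁻¹ * (W + X) * (1 + W * X)⁻¹ * (1 - W)) (pT Z) (E (pM Z)))) ∧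
      κ ≠ 0 ∧ κ ≠ ∞ ∧
      (∀ B ⊆ (Λ 0 : Set (Matrix (Fin m) (Fin m) K)), MeasurableSet (c '' B) → κ * ν (c '' B) = μ B) ∧
      -- ── second block: the slot formula and ★ (TJ3)'s two laws for `L` at `N := ρ (b₀ ε b₀)`
      (∀ W, E W = J⁻¹ * (W.map σ)ᵀ * J) ∧
      (∀ X, X * ((ρ (b₀ * ε b₀) : GL (Fin m) K) : Matrix (Fin m) (Fin m) K) = ((ρ (b₀ * ε b₀) : GL (Fin m) K) : Matrix (Fin m) (Fin m) K) * X → L X = X) ∧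
      (∀ X Y : Matrix (Fin m) (Fin m) K, X = ((ρ (b₀ * ε b₀) : GL (Fin m) K) : Matrix (Fin m) (Fin m) K) * Y * (((ρ (b₀ * ε b₀))⁻¹ : GL (Fin m) K) : Matrix (Fin m) (Fin m) K) - Y →
        L X = (((ρ b₀)⁻¹ : GL (Fin m) K) : Matrix (Fin m) (Fin m) K) * X * ((ρ b₀ : GL (Fin m) K) : Matrix (Fin m) (Fin m) K) + J⁻¹ * (X.map σ)ᵀ * J) ∧
      (∀ Z, pT Z * ((ρ (b₀ * ε b₀) : GL (Fin m) K) : Matrix (Fin m) (Fin m) K) = ((ρ (b₀ * ε b₀) : GL (Fin m) K) : Matrix (Fin m) (Fin m) K) * pT Z) ∧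
      (∀ X, X * ((ρ (b₀ * ε b₀) : GL (Fin m) K) : Matrix (Fin m) (Fin m) K) = ((ρ (b₀ * ε b₀) : GL (Fin m) K) : Matrix (Fin m) (Fin m) K) * X → pM X = 0) ∧
      -- ── third block: the scaling letters of ★ `exists_depth` and the level kit
      (∀ (a : K) Z, pM (a • Z) = a • pM Z) ∧ (∀ (a : K) Z, pT (a • Z) = a • pT Z) ∧
      (∀ a : K, σ a = a → ∀ Z, L (a • Z) = a • L Z) ∧ (∀ a : K, σ a = a → ∀ Z, L.symm (a • Z) = a • L.symm Z) ∧
      c 0 = 1 ∧ (∀ j, IsOpen (Λ j : Set (Matrix (Fin m) (Fin m) K))) ∧ (∀ j, IsCompact (Λ j : Set (Matrix (Fin m) (Fin m) K))) := by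
  -- ### instances on `M_m(K)` from `K`
  haveI : SecondCountableTopology (Matrix (Fin m) (Fin m) K) := inferInstanceAs (SecondCountableTopology (Fin m → Fin m → K))
  haveI : LocallyCompactSpace K := inferInstance
  -- ### (β) the `GLₘ` Cayley chart package (★ (M-2))
  obtain ⟨Λ, c, σV, κ, hΛ, hc, hσ, hσVc, hcc, hK0, hκ0, hκt, hchart⟩ := exists_glChart ρ hρ hρinj hρsurj hα hα1 h2 μ ν
  have hι : IsClosedEmbedding ⇑(AddMonoidHom.id (Matrix (Fin m) (Fin m) K)) := IsClosedEmbedding.id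
  have hΛ' : ∀ j X, X ∈ Λ j ↔ ValBound (α ^ (j + 1)) ((AddMonoidHom.id (Matrix (Fin m) (Fin m) K)) X) := hΛ
  have h0c : c 0 = 1 := by
    apply hρinj
    apply Units.ext
    rw [hc 0 (zero_mem _), map_one, Units.val_one, cayley_def, add_zero, sub_zero, inv_one, Matrix.mul_one]
  have hopenΛ : ∀ j, IsOpen (Λ j : Set (Matrix (Fin m) (Fin m) K)) := isOpen_level (AddMonoidHom.id _) Λ hι.continuous hΛ' hα
  have hcompΛ : ∀ j, IsCompact (Λ j : Set (Matrix (Fin m) (Fin m) K)) := isCompact_level (AddMonoidHom.id _) Λ hι hΛ'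
  -- ### (γ) the twisted Cartan data at `N := ρ (b₀ ε b₀)` (★ (M-1))
  set b : GL (Fin m) K := ρ b₀ with hbdef
  set Nm : GL (Fin m) K := ρ (b₀ * ε b₀) with hNmdef
  have hN : (Nm : Matrix (Fin m) (Fin m) K) = (b : Matrix (Fin m) (Fin m) K) * (J⁻¹ * (((b⁻¹ : GL (Fin m) K) : Matrix (Fin m) (Fin m) K).map σ)ᵀ * J) := by
    rw [hNmdef, map_mul, Units.val_mul, hερ b₀]
  have hcommM : (b : Matrix (Fin m) (Fin m) K) * (J⁻¹ * (((b⁻¹ : GL (Fin m) K) : Matrix (Fin m) (Fin m) K).map σ)ᵀ * J) =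
      (J⁻¹ * (((b⁻¹ : GL (Fin m) K) : Matrix (Fin m) (Fin m) K).map σ)ᵀ * J) * (b : Matrix (Fin m) (Fin m) K) := by
    have h := congrArg (fun g : G => ((ρ g : GL (Fin m) K) : Matrix (Fin m) (Fin m) K)) hcomm
    simp only [map_mul, Units.val_mul] at h
    rwa [hερ b₀] at h
  obtain ⟨pM, pT, L, hsum, hidem, hpMc, hpTc, hpTz, hkerpM, -, hL, hLz, hLm, hpMs, hpTs, hLs, hLss⟩ :=
    exists_twistedLinearEquiv σ hσc hσ2 h2 J hJ hJh b Nm hN hcommM hsep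
  -- ### (δ) the chart link to `T = Cent(γ)`
  have htγ : Commute ((Nm : GL (Fin m) K) : Matrix (Fin m) (Fin m) K) (γ : Matrix (Fin m) (Fin m) K) := by
    have h := (hT _).1 (T.mul_mem hb₀ hεb₀)
    have h' := congrArg (fun g : GL (Fin m) K => (g : Matrix (Fin m) (Fin m) K)) h
    show (Nm : Matrix (Fin m) (Fin m) K) * (γ : Matrix (Fin m) (Fin m) K) = (γ : Matrix (Fin m) (Fin m) K) * (Nm : Matrix (Fin m) (Fin m) K)
    simpa only [Units.val_mul] using h'
  obtain ⟨hcT, hTc⟩ := chart_link_gl ρ hΛ hα1 h2 c hc pM pT hsum Nm hpTz hkerpM hsep hγsep htγ hT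
  -- ### (ε) the slot `E = τ` and the twist in the chart
  obtain ⟨E, hEdef⟩ := exists_tauHom σ J (m := Fin m)
  have hE : ∀ (δ : ValueGroupWithZero K) (W : Matrix (Fin m) (Fin m) K), ValBound δ W → ValBound δ (E W) := fun δ W hW => by
    rw [hEdef]; exact valBound_tau σ J hσv hJ1 hJi1 hW
  have hEc : Continuous E := by
    have : (E : Matrix (Fin m) (Fin m) K → Matrix (Fin m) (Fin m) K) = fun W => J⁻¹ * (W.map σ)ᵀ * J := funext hEdef
    rw [this]; exact continuous_tau σ J hσc
  have hε : ∀ X ∈ Λ 0, (((ρ (ε (c X)))⁻¹ : GL (Fin m) K) : Matrix (Fin m) (Fin m) K) = cayley (E X) := fun X hX => by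
    rw [hEdef]; exact rho_eps_chart_inv_eq_cayley_tau σ J ρ hJ hσv hJ1 hJi1 ε hερ hΛ hα1 c hc X hX
  -- ### assemble
  refine ⟨Λ, c, σV, κ, pM, pT, L, E,
    fun Z => (1 - pM Z)⁻¹ * (pM Z + pT Z) * (1 + pM Z * pT Z)⁻¹ * (1 - pM Z),
    fun Z => (fun W X : Matrix (Fin m) (Fin m) K => (1 - W)⁻¹ * (W + X) * (1 + W * X)⁻¹ * (1 - W))
      ((((ρ b₀)⁻¹ : GL (Fin m) K) : Matrix (Fin m) (Fin m) K) * pM Z * ((ρ b₀ : GL (Fin m) K) : Matrix (Fin m) (Fin m) K))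
      ((fun W X : Matrix (Fin m) (Fin m) K => (1 - W)⁻¹ * (W + X) * (1 + W * X)⁻¹ * (1 - W)) (pT Z) (E (pM Z))),
    hΛ, hc, hcc, hK0, hσ, hσVc, hsum, hidem, hpMc, hpTc, fun Z => rfl, hcT, hTc, hE, hEc, fun Z => ?_, hε, fun Z => rfl, hκ0, hκt, hchart,
    hEdef, hLz, hLm, hpTz, hkerpM, hpMs, hpTs, hLs, hLss, h0c, hopenΛ, hcompΛ⟩
  rw [hL Z, hEdef]

end Summit.HodgeConjecture.HodgeConjecture.R90.S4
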